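/-
COR-CM (cell pub-hodgecm2) — ¬hJ RUSH, HEAD-B (EDITION B) input R1 «`J′^*_K` bijective» FROM THE ONE DISPLAYED PRINT ROW
[Liu2021, Lem. 2.4 (1)] (Literature named fact `Liu2021.albanese_bettiOne_pullback_bijective`, leaf `Liu2021/Lemma24BettiAlbanese`).
Pen mukey-p9 (prover-pub-hodgecm2-mukey-p9-g6-0) on d2bridge-prove-5's R1 bricks (`BettiCofanAdditivity`, `NotHJLevelQRepresentatives`;
§1 below = prove-5's `AlbStarQValue.section` with credit) and nothj-p5's `𝟙_A ≠ 0` argument (§4, with credit).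
THEOREMS ONLY (kernel lane); no `def`, no `sorry`, no `variable`; nothing landed is edited or restated.
FRAMING: HC_CM is NOT proved; «Δ2 BRIDGE CLOSED» is NOT claimed; nothing here asserts hJ, hJ₀, (P-K), R1 or their negations;
[Liu2021, Lem. 2.4 (1)] enters ONLY as the hypothesis `(hL : albanese_bettiOne_pullback_bijective)`.
-/
import Literature.AlgebraicGeometry.Motives.BettiCofanAdditivity
import Literature.NumberTheory.Automorphic.Liu2021.Lemma24BettiAlbanese
import Summits.HodgeConjecture.CorCM.D2Bridge.NotHJLevelQRepresentatives
import Summits.HodgeConjecture.CorCM.D2Bridge.NotHJLevelQRepsColimit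
import Summits.HodgeConjecture.CorCM.D2Bridge.ComponentAlbanesePinLaw
import HarnessLib

set_option autoImplicit false

/-!
# R1 for the tree's pin `componentAlbanesePinTotal` from [Liu2021] Lemma 2.4 (1) AS PRINTED

HEAD-B's core (`NotHJ.false_of_records_of_multOne_of_PK`, hmusep-p5) takes a record `J'` with INJECTIVE rational pull-backs
`hinj : ∀ K, Injective (J'.albStarQ K)` and ONE Albanese variety with `h1 : 𝟙 (C.A K₀) ≠ 0`.  At the intended value
`J' := componentAlbanesePinTotal …` (the (4.2)∕(4.3) record of [Liu2021] §4.2 built in ✔ `ComponentAlbanesePinLaw`) both are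
CONSEQUENCES of the one Hodge-blind, orientation-free print row [Liu2021, Lem. 2.4 (1)] «`(α_X)_x^* : H¹_{B,τ}(Alb_X, ℚ) ≃ H¹_{B,τ}(X, ℚ)`»
(`Literature.NumberTheory.Automorphic.Liu2021.albanese_bettiOne_pullback_bijective`), instantiated at `k := L`, `τ := ῑ₁`, `X := X_K`,
`a := ℭ.alb K`, `x := (basePt K (g q))_q` with NO glue:

* §1 (d2bridge-prove-5, `AlbStarQValue.section`): with the components at double-coset representatives as a coproduct cofan of `X_K ⊗_ῑ₁ ℂ`
  (leaf `NotHJLevelQRepsColimit`: `exists_representatives_isColimit_componentInj`), `J^*_K` is bijective iff `(α_K)_x^*` is (`albStarQ_bijective_iff_pull_albTotal_bijective`,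
  by ✔ `BettiCofan.bijective_pi_pull` and ✔ `LevelQReps.bijective_albStarQ_iff_bijective_albStarReps_of_representatives`); transport to the
  total carrier (`forall_bijective_albStarQ_pinTotal_iff`).
* §2: the Literature row in the `albOnPiece` currency (`NotHJ.bijective_pull_desc_albOnPiece_of_lemma24`; lift `ℓ := nablaLiftPiece`).
* §3: R1 — `bijective_albStarQ_componentAlbanesePin[_Total]_of_lemma24`, and `injective_…` (= the core's `hinj`).
* §4 (nothj-p5's argument): `one_ne_zero_of_lemma24` (= the core's `h1`, given one non-zero rational level vector at `K₀`).

[Liu2021] Y. Liu, *Fourier–Jacobi cycles and arithmetic relative trace formula*, Camb. J. Math. 9 (2021) = arXiv:2102.11518: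
Lemma 2.4 (1) (FJcycle.tex l. 1210–1228), §4.2 (l. 2053–2074).
-/

noncomputable section

/-! ## §1 `J^*_K` of the pin versus `(α_K)_x^*` (d2bridge-prove-5's `AlbStarQValue.section`, binders made explicit, `albTotal` displayed) -/

namespace Summit.HodgeConjecture.CorCM.D2Bridge.LevelQReps

open Function CategoryTheory CategoryTheory.Limits AlgebraicGeometry NumberField
open Literature.AlgebraicGeometry.Motives Literature.AlgebraicGeometry.HodgeTheory Literature.AlgebraicGeometry.ShimuraVarieties
open Literature.AlgebraicGeometry.ShimuraVarieties.UnitaryCanonicalModel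
open Literature.AlgebraicGeometry.Motives.AbelianVariety (Hom.baseChange)
open Literature.AlgebraicGeometry.HodgeTheory.BettiUniverse (pull pull_id)
open Literature.NumberTheory.Automorphic Literature.NumberTheory.Automorphic.UnitaryGroup Literature.NumberTheory.Automorphic.PicardCM
open Literature.NumberTheory.Automorphic.Liu2021 Literature.NumberTheory.Automorphic.Liu2021.AppendixC
open Literature.NumberTheory.Transcendental (Arapura2012_Cor_15_4_6)
open Summit.HodgeConjecture.CorCM.Model Summit.HodgeConjecture.CorCM.HComp
open HodgeCM.Model HodgeCM.Model.LevelTranslate HodgeCM.Model.TowerLevel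
open Summit.HodgeConjecture.CorCM.D2Bridge
open AbelianVariety (bcFunctor)
open Literature.NumberTheory.Automorphic.ShimuraDissection (CosetSpace)

/-- **R1 for the value ⟺ [Liu2021] Lem. 2.4 (1) AS PRINTED** at `X = X_K`, `τ = ῑ₁`, `x = (basePt K (g q))_q`: the pin's `J^*_K`
(`albStarQ K` into the rational level `levelQ Γ_K`) is bijective iff `(α_K)_x^*` is, where
`(α_K)_x := hcol.desc [alb K (g q)]_q : X_K ⊗_ῑ₁ ℂ ⟶ A_K ⊗_ῑ₁ ℂ` is Liu's Albanese morphism for the choice of one base point per component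
([Liu2021] proof of Lem. 2.4 (1), l. 1220–1222) — by Betti additivity over the component cofan (✔ `BettiCofan.bijective_pi_pull`) and the
double-coset representatives (✔ `bijective_albStarQ_iff_bijective_albStarReps_of_representatives`).  (d2bridge-prove-5.)
[cite: Liu2021, Lemma 2.4 (1) (FJcycle.tex l. 1210–1228)] [cite: Deligne1979ShimuraVarieties, §2.1.2] -/
theorem albStarQ_bijective_iff_pull_albTotal_bijective {L : HodgeCM.CMField} {ι₁ : L →+* ℂ} (V : HodgeCM.HermSpace3 L ι₁)
    (hU : BallQuotientUniformisedDatum) (h₃ : CMAbelianVarietyRealised) (h4 : 4 ≤ Module.finrank ℚ L)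
    (h : exists_recordSystem) (hHD : exists_isReal_hodgeModel) [Algebra L ℂ] (hι : (algebraMap L ℂ).comp (cmConjRingHom L) = ι₁)
    (hI : hodgePQ_independent_of_hodgeModel) (hA : Arapura2012_Cor_15_4_6) (hU7 : heckeTranslate_definedOver)
    (Φ : CMType (pkgF L)) (iso : ℕ → Prop) (K : C5.SmallLevel (K3 (pkgV V)))
    (g : MulAction.orbitRel.Quotient ↥(Urat V) (CosetSpace (ρ V) (levelOf V K).K) → V.adelicFin)
    (hg : ∀ q, (Quotient.mk'' (ShimuraDissection.CosetSpace.pt (ρ V) (levelOf V K).K (g q)) :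
      MulAction.orbitRel.Quotient ↥(Urat V) (CosetSpace (ρ V) (levelOf V K).K)) = q)
    (hcol : IsColimit (Cofan.mk ((bcFunctor L ℂ).obj (XK V h K)) (fun q => componentInj V hU h₃ h4 h hHD hι K (g q)))) :
    Bijective ((componentAlbanesePin hHD hI hU h₃ hA hU7 V h h4 hι Φ iso).albStarQ K) ↔
      Bijective (BettiUniverse.pull
        (hcol.desc (Cofan.mk _ fun q => (componentAlbanesePin hHD hI hU h₃ hA hU7 V h h4 hι Φ iso).alb K (g q))) 1) := by
  haveI : Finite (MulAction.orbitRel.Quotient ↥(Urat V) (CosetSpace (ρ V) (levelOf V K).K)) :=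
    Summit.HodgeConjecture.CorCM.Model.finite_shimuraIndex (pkgV V) h4 (K.1.1 : Subgroup V.adelicFin) K.1.2.1
  rw [bijective_albStarQ_iff_bijective_albStarReps_of_representatives hHD hI hU h₃ hA
    (componentAlbanesePin hHD hI hU h₃ hA hU7 V h h4 hι Φ iso) K g hg]
  -- `componentInj K (g q) ≫ (α_K)_x = alb K (g q)`
  have hfacq : ∀ q, componentInj V hU h₃ h4 h hHD hι K (g q) ≫
      hcol.desc (Cofan.mk _ fun q => (componentAlbanesePin hHD hI hU h₃ hA hU7 V h h4 hι Φ iso).alb K (g q)) =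
        (componentAlbanesePin hHD hI hU h₃ hA hU7 V h h4 hι Φ iso).alb K (g q) := fun q =>
    hcol.fac (Cofan.mk _ fun q => (componentAlbanesePin hHD hI hU h₃ hA hU7 V h h4 hι Φ iso).alb K (g q)) ⟨q⟩
  -- `albStarReps = (Betti additivity) ∘ (α_K)_x^*`
  have hfac : ⇑(albStarReps hHD hI hU h₃ hA (componentAlbanesePin hHD hI hU h₃ hA hU7 V h h4 hι Φ iso) K g) =
      (fun (x : bettiCohomology ((bcFunctor L ℂ).obj (XK V h K)) 1) (q : MulAction.orbitRel.Quotient ↥(Urat V)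
          (CosetSpace (ρ V) (levelOf V K).K)) => BettiUniverse.pull (componentInj V hU h₃ h4 h hHD hι K (g q)) 1 x) ∘
        ⇑(BettiUniverse.pull
          (hcol.desc (Cofan.mk _ fun q => (componentAlbanesePin hHD hI hU h₃ hA hU7 V h h4 hι Φ iso).alb K (g q))) 1) := by
    funext x q
    rw [Function.comp_apply, albStarReps_apply, ← hfacq q]
    exact LinearMap.congr_fun (BettiUniverse.pull_comp (componentInj V hU h₃ h4 h hHD hι K (g q))
      (hcol.desc (Cofan.mk _ fun q => (componentAlbanesePin hHD hI hU h₃ hA hU7 V h h4 hι Φ iso).alb K (g q))) 1) x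
  have key : Bijective ⇑(albStarReps hHD hI hU h₃ hA (componentAlbanesePin hHD hI hU h₃ hA hU7 V h h4 hι Φ iso) K g) ↔
      Bijective ⇑(BettiUniverse.pull
        (hcol.desc (Cofan.mk _ fun q => (componentAlbanesePin hHD hI hU h₃ hA hU7 V h h4 hι Φ iso).alb K (g q))) 1) := by
    rw [hfac]
    exact (Literature.AlgebraicGeometry.Motives.BettiCofan.bijective_pi_pull hcol 1).of_comp_iff' _
  exact key

/-- Transport of R1 along an equality of §4.2 data (`ComponentAlbanese.transport` is a `subst`). [folklore] -/
theorem forall_bijective_albStarQ_transport_iff {L : HodgeCM.CMField} {ι₁ : L →+* ℂ} (V : HodgeCM.HermSpace3 L ι₁)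
    (hU : BallQuotientUniformisedDatum) (h₃ : CMAbelianVarietyRealised) (h4 : 4 ≤ Module.finrank ℚ L)
    (h : exists_recordSystem) (hHD : exists_isReal_hodgeModel) [Algebra L ℂ] (hι : (algebraMap L ℂ).comp (cmConjRingHom L) = ι₁)
    (hI : hodgePQ_independent_of_hodgeModel) (hA : Arapura2012_Cor_15_4_6) (hU7 : heckeTranslate_definedOver)
    (Φ : CMType (pkgF L)) (iso : ℕ → Prop)
    {C' : Sec42Data (honestP5Of h (pkgF L) ι₁ (pkgV V) Φ) iso} (e : sec42DataOfFourLe h (pkgV V) Φ h4 iso = C') :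
    (∀ K, Bijective (((componentAlbanesePin hHD hI hU h₃ hA hU7 V h h4 hι Φ iso).transport e).albStarQ K)) ↔
      (∀ K, Bijective ((componentAlbanesePin hHD hI hU h₃ hA hU7 V h h4 hι Φ iso).albStarQ K)) := by
  subst e
  exact Iff.rfl

/-- **R1 at the TOTAL carrier** (the datum of hJ₀ and of the END displays, `Model.sec42DataOf …`): `componentAlbanesePinTotal` is the
transport of `componentAlbanesePin` along ✔ `sec42DataOf_eq_of_four_le`, so `J′^*_K` is bijective at every level of the total carrier iff
it is at every level of the explicit carrier (d2bridge-prove-5). [cite: Liu2021, §4.2 l. 2053–2074, Lemma 2.4 (1)] -/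
theorem forall_bijective_albStarQ_pinTotal_iff {L : HodgeCM.CMField} {ι₁ : L →+* ℂ} (V : HodgeCM.HermSpace3 L ι₁)
    (hU : BallQuotientUniformisedDatum) (h₃ : CMAbelianVarietyRealised) (h4 : 4 ≤ Module.finrank ℚ L)
    (h : exists_recordSystem) (hHD : exists_isReal_hodgeModel) [Algebra L ℂ] (hι : (algebraMap L ℂ).comp (cmConjRingHom L) = ι₁)
    (hI : hodgePQ_independent_of_hodgeModel) (hA : Arapura2012_Cor_15_4_6) (hU7 : heckeTranslate_definedOver)
    (Φ : CMType (pkgF L))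
    (isoF : ∀ (F : Summit.HodgeConjecture.CorCM.CMField) (ι : F →+* ℂ) (_ : Summit.HodgeConjecture.CorCM.HermSpace3 F ι)
      (_ : CMType F), ℕ → Prop) :
    (∀ K, Bijective ((componentAlbanesePinTotal hHD hI hU h₃ hA hU7 V h h4 hι Φ isoF).albStarQ K)) ↔
      (∀ K, Bijective ((componentAlbanesePin hHD hI hU h₃ hA hU7 V h h4 hι Φ (isoF (pkgF L) ι₁ (pkgV V) Φ)).albStarQ K)) :=
  forall_bijective_albStarQ_transport_iff V hU h₃ h4 h hHD hι hI hA hU7 Φ (isoF (pkgF L) ι₁ (pkgV V) Φ)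
    (sec42DataOf_eq_of_four_le h (pkgV V) Φ isoF h4).symm

end Summit.HodgeConjecture.CorCM.D2Bridge.LevelQReps

/-! ## §2 The Literature row in the `albOnPiece` currency -/

namespace Summit.HodgeConjecture.CorCM.D2Bridge.NotHJ

open CategoryTheory CategoryTheory.Limits AlgebraicGeometry MonoidalCategory CartesianMonoidalCategory
open Literature.AlgebraicGeometry.Motives Literature.AlgebraicGeometry.HodgeTheory
open Literature.NumberTheory.Automorphic.Liu2021 Literature.NumberTheory.Automorphic.Liu2021.AppendixC
open AbelianVariety (bcFunctor)

/-- **[Liu2021, Lem. 2.4 (1)] in the `albOnPiece` currency**: from the Literature row, for a proper smooth `X / k` (`k → ℂ`), an Albanese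
datum `a`, a colimit cofan of geometrically irreducible complex pieces `inj q : Y q ⟶ X ⊗_k ℂ` with base points `x q`, the pull-back along
`(α_X)_x = [albOnPiece a (inj q) (x q)]_q` is bijective on `H¹(−;ℚ)` (lift `ℓ := nablaLiftPiece`, ✔ `nablaLiftPiece_incl`, `albOnPiece_def`,
`albPair_def`, `rfl`). [cite: Liu2021, Lemma 2.4 (1) (FJcycle.tex l. 1210–1228)] -/
theorem bijective_pull_desc_albOnPiece_of_lemma24 (hL : albanese_bettiOne_pullback_bijective)
    {k : Type} [Field k] [CharZero k] [Algebra k ℂ] {X : SchemeOver k} [IsProper X.hom] [Smooth X.hom]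
    (a : Albanese X) {Ξ : Type} (Y : Ξ → SchemeOver ℂ) [∀ q, GeometricallyIrreducible (Y q).hom]
    (inj : ∀ q, Y q ⟶ (bcFunctor k ℂ).obj X) (hcol : IsColimit (Cofan.mk ((bcFunctor k ℂ).obj X) inj))
    (x : ∀ q, AlgPoints (Y q) ℂ) :
    Function.Bijective
      (BettiUniverse.pull (hcol.desc (Cofan.mk (a.Alb.baseChange ℂ).X fun q => albOnPiece a (inj q) (x q))) 1) := by
  refine hL k X inferInstance inferInstance a Ξ Y inj hcol x (fun q => nablaLiftPiece a (inj q))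
    (fun q => nablaLiftPiece_incl a (inj q)) _ fun q => ?_
  have e : inj q ≫ hcol.desc (Cofan.mk (a.Alb.baseChange ℂ).X fun q => albOnPiece a (inj q) (x q)) =
      albOnPiece a (inj q) (x q) :=
    hcol.fac (Cofan.mk (a.Alb.baseChange ℂ).X fun q => albOnPiece a (inj q) (x q)) ⟨q⟩
  refine e.trans ?_
  rw [albOnPiece_def, albPair_def]
  rfl

end Summit.HodgeConjecture.CorCM.D2Bridge.NotHJ

/-! ## §3 R1 for the pin value from the displayed row -/

namespace Summit.HodgeConjecture.CorCM.D2Bridge.LevelQReps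

open Function CategoryTheory CategoryTheory.Limits AlgebraicGeometry NumberField
open Literature.AlgebraicGeometry.Motives Literature.AlgebraicGeometry.HodgeTheory Literature.AlgebraicGeometry.ShimuraVarieties
open Literature.AlgebraicGeometry.ShimuraVarieties.UnitaryCanonicalModel
open Literature.AlgebraicGeometry.Motives.AbelianVariety (Hom.baseChange)
open Literature.AlgebraicGeometry.HodgeTheory.BettiUniverse (pull pull_id)
open Literature.NumberTheory.Automorphic Literature.NumberTheory.Automorphic.UnitaryGroup Literature.NumberTheory.Automorphic.PicardCM
open Literature.NumberTheory.Automorphic.Liu2021 Literature.NumberTheory.Automorphic.Liu2021.AppendixC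
open Literature.NumberTheory.Transcendental (Arapura2012_Cor_15_4_6)
open Summit.HodgeConjecture.CorCM.Model Summit.HodgeConjecture.CorCM.HComp
open HodgeCM.Model HodgeCM.Model.LevelTranslate HodgeCM.Model.TowerLevel
open Summit.HodgeConjecture.CorCM.D2Bridge
open AbelianVariety (bcFunctor)
open Literature.NumberTheory.Automorphic.ShimuraDissection (CosetSpace)

/-- **R1 at Liu's explicit §4.2 carrier from the displayed print row** [Liu2021, Lem. 2.4 (1)]
(`Liu2021.albanese_bettiOne_pullback_bijective`) instantiated at `k := L`, `τ := ῑ₁`, `X := X_K` (proper: ✔ `IsProjectiveOver.isProper`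
on `projective_X K`; smooth: Mathlib `SmoothOfRelativeDimension.smooth` on `smooth_X K`), `a := ℭ.alb K`, the component cofan at
double-coset representatives (`exists_representatives_isColimit_componentInj`) and `x := (basePt K (g q))_q`; then §1's reduction.
[cite: Liu2021, Lemma 2.4 (1) (FJcycle.tex l. 1210–1228)] -/
theorem bijective_albStarQ_componentAlbanesePin_of_lemma24 (hL : albanese_bettiOne_pullback_bijective)
    {L : HodgeCM.CMField} {ι₁ : L →+* ℂ} (V : HodgeCM.HermSpace3 L ι₁)
    (hU : BallQuotientUniformisedDatum) (h₃ : CMAbelianVarietyRealised) (h4 : 4 ≤ Module.finrank ℚ L)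
    (h : exists_recordSystem) (hHD : exists_isReal_hodgeModel) [Algebra L ℂ] (hι : (algebraMap L ℂ).comp (cmConjRingHom L) = ι₁)
    (hI : hodgePQ_independent_of_hodgeModel) (hA : Arapura2012_Cor_15_4_6) (hU7 : heckeTranslate_definedOver)
    (Φ : CMType (pkgF L)) (iso : ℕ → Prop) (K : C5.SmallLevel (K3 (pkgV V))) :
    Bijective ((componentAlbanesePin hHD hI hU h₃ hA hU7 V h h4 hι Φ iso).albStarQ K) := by
  obtain ⟨g, hg, ⟨hcol⟩⟩ := exists_representatives_isColimit_componentInj V hU h₃ h4 h hHD hι K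
  rw [albStarQ_bijective_iff_pull_albTotal_bijective V hU h₃ h4 h hHD hι hI hA hU7 Φ iso K g hg hcol]
  haveI := (compactifiedOf h (pkgV V) Φ h4).smooth_X K
  haveI : Smooth ((compactifiedOf h (pkgV V) Φ h4).X.obj K).hom :=
    SmoothOfRelativeDimension.smooth ((honestP5Of h (pkgF L) ι₁ (pkgV V) Φ).n - 1) _
  haveI : IsProper ((compactifiedOf h (pkgV V) Φ h4).X.obj K).hom :=
    IsProjectiveOver.isProper ((compactifiedOf h (pkgV V) Φ h4).projective_X K)
  haveI : ∀ q, GeometricallyIrreducible (P V hU h₃ K (g q)).hom := fun q => geometricallyIrreducible_pms hU h₃ (code V K (g q))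
  exact NotHJ.bijective_pull_desc_albOnPiece_of_lemma24 hL (X := (compactifiedOf h (pkgV V) Φ h4).X.obj K)
    ((sec42DataOfFourLe h (pkgV V) Φ h4 iso).alb K) (fun q => P V hU h₃ K (g q))
    (fun q => componentInj V hU h₃ h4 h hHD hι K (g q)) hcol (fun q => basePt V hU h₃ K (g q))

/-- **R1 at the TOTAL carrier** (`componentAlbanesePinTotal`, the datum of hJ₀ ∕ the END displays ∕ the intended `J'` of HEAD-B's core):
`J′^*_K` is bijective at every level, MODULO the one displayed print row. [cite: Liu2021, Lemma 2.4 (1) (FJcycle.tex l. 1210–1228); §4.2 l. 2053–2074] -/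
theorem bijective_albStarQ_componentAlbanesePinTotal_of_lemma24 (hL : albanese_bettiOne_pullback_bijective)
    {L : HodgeCM.CMField} {ι₁ : L →+* ℂ} (V : HodgeCM.HermSpace3 L ι₁)
    (hU : BallQuotientUniformisedDatum) (h₃ : CMAbelianVarietyRealised) (h4 : 4 ≤ Module.finrank ℚ L)
    (h : exists_recordSystem) (hHD : exists_isReal_hodgeModel) [Algebra L ℂ] (hι : (algebraMap L ℂ).comp (cmConjRingHom L) = ι₁)
    (hI : hodgePQ_independent_of_hodgeModel) (hA : Arapura2012_Cor_15_4_6) (hU7 : heckeTranslate_definedOver)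
    (Φ : CMType (pkgF L))
    (isoF : ∀ (F : Summit.HodgeConjecture.CorCM.CMField) (ι : F →+* ℂ) (_ : Summit.HodgeConjecture.CorCM.HermSpace3 F ι)
      (_ : CMType F), ℕ → Prop) :
    ∀ K, Bijective ((componentAlbanesePinTotal hHD hI hU h₃ hA hU7 V h h4 hι Φ isoF).albStarQ K) :=
  (forall_bijective_albStarQ_pinTotal_iff V hU h₃ h4 h hHD hι hI hA hU7 Φ isoF).2
    (fun K' => bijective_albStarQ_componentAlbanesePin_of_lemma24 hL V hU h₃ h4 h hHD hι hI hA hU7 Φ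
      (isoF (pkgF L) ι₁ (pkgV V) Φ) K')

/-- **HEAD-B's `hinj` at `J' := componentAlbanesePinTotal …`**: injectivity of `J′^*_K` at every level — the `.1` of bijectivity —
from the displayed print row. [cite: Liu2021, Lemma 2.4 (1) (FJcycle.tex l. 1210–1228)] -/
theorem injective_albStarQ_componentAlbanesePinTotal_of_lemma24 (hL : albanese_bettiOne_pullback_bijective)
    {L : HodgeCM.CMField} {ι₁ : L →+* ℂ} (V : HodgeCM.HermSpace3 L ι₁)
    (hU : BallQuotientUniformisedDatum) (h₃ : CMAbelianVarietyRealised) (h4 : 4 ≤ Module.finrank ℚ L)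
    (h : exists_recordSystem) (hHD : exists_isReal_hodgeModel) [Algebra L ℂ] (hι : (algebraMap L ℂ).comp (cmConjRingHom L) = ι₁)
    (hI : hodgePQ_independent_of_hodgeModel) (hA : Arapura2012_Cor_15_4_6) (hU7 : heckeTranslate_definedOver)
    (Φ : CMType (pkgF L))
    (isoF : ∀ (F : Summit.HodgeConjecture.CorCM.CMField) (ι : F →+* ℂ) (_ : Summit.HodgeConjecture.CorCM.HermSpace3 F ι)
      (_ : CMType F), ℕ → Prop) :
    ∀ K, Injective ((componentAlbanesePinTotal hHD hI hU h₃ hA hU7 V h h4 hι Φ isoF).albStarQ K) :=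
  fun K => (bijective_albStarQ_componentAlbanesePinTotal_of_lemma24 hL V hU h₃ h4 h hHD hι hI hA hU7 Φ isoF K).1

/-! ## §4 HEAD-B's `h1 : 𝟙 (C.A K₀) ≠ 0` from the same row (nothj-p5's argument) -/

/-- `(0 : A ⟶ B) ⊗ ℂ = 0` for abelian varieties over a field `E → ℂ` (nothj-p5). [cite: GortzWedhorn2020, Remark 16.54] -/
theorem hom_baseChange_zero' {E : Type} [Field E] [Algebra E ℂ] (A B : AbelianVariety E) :
    Hom.baseChange ℂ (0 : A ⟶ B) = 0 := by
  have hadd := AbelianVariety.Hom.baseChange_add ℂ (0 : A ⟶ B) 0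
  rw [add_zero] at hadd
  exact add_eq_left.1 hadd.symm

/-- **`H¹((A ⊗ ℂ)(ℂ); ℚ) ∋ x ≠ 0 ⇒ 𝟙_A ≠ 0`** (nothj-p5): if `𝟙_A = 0` then `id = (𝟙_A ⊗ ℂ)^* = 0^* = 0` on `H¹`.
[cite: HatcherAT2002, §3.1 p. 198] -/
theorem one_ne_zero_of_exists_betti_ne_zero' {E : Type} [Field E] [Algebra E ℂ] (A : AbelianVariety E)
    (hx : ∃ x : bettiCohomology (A.baseChange ℂ).X 1, x ≠ 0) : (𝟙 A : A ⟶ A) ≠ 0 := by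
  obtain ⟨x, hx⟩ := hx
  intro h1
  apply hx
  have hid : pull (Hom.baseChange ℂ (𝟙 A)).hom.hom.hom 1 x = x := by
    rw [AbelianVariety.Hom.baseChange_id]
    exact LinearMap.congr_fun (pull_id (A.baseChange ℂ).X 1) x
  rw [h1, hom_baseChange_zero', pull_zero_one, LinearMap.zero_apply] at hid
  exact hid.symm

/-- **HEAD-B's `h1` from the displayed print row**: at any level `K₀` of the total carrier carrying ONE non-zero rational level vector
`c ∈ levelQ Γ_{K₀}`, `𝟙 (A_{K₀}) ≠ 0` — by the SURJECTIVITY half of [Liu2021, Lem. 2.4 (1)] (`c = J′^*_{K₀} x` with `x ≠ 0`) and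
`one_ne_zero_of_exists_betti_ne_zero'`.  The supplier of `c` is the consumer's (any non-zero class at one representative).
[cite: Liu2021, Lemma 2.4 (1) (FJcycle.tex l. 1210–1228)] -/
theorem one_ne_zero_of_lemma24 (hL : albanese_bettiOne_pullback_bijective)
    {L : HodgeCM.CMField} {ι₁ : L →+* ℂ} (V : HodgeCM.HermSpace3 L ι₁)
    (hU : BallQuotientUniformisedDatum) (h₃ : CMAbelianVarietyRealised) (h4 : 4 ≤ Module.finrank ℚ L)
    (h : exists_recordSystem) (hHD : exists_isReal_hodgeModel) [Algebra L ℂ] (hι : (algebraMap L ℂ).comp (cmConjRingHom L) = ι₁)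
    (hI : hodgePQ_independent_of_hodgeModel) (hA : Arapura2012_Cor_15_4_6) (hU7 : heckeTranslate_definedOver)
    (Φ : CMType (pkgF L))
    (isoF : ∀ (F : Summit.HodgeConjecture.CorCM.CMField) (ι : F →+* ℂ) (_ : Summit.HodgeConjecture.CorCM.HermSpace3 F ι)
      (_ : CMType F), ℕ → Prop)
    (K₀ : C5.SmallLevel (sec42DataOf h isoF (pkgF L) ι₁ (pkgV V) Φ).S.K₀)
    (hK : ∃ c : TowerRational.levelQ hHD hI hU h₃ hA ((componentAlbanesePinTotal hHD hI hU h₃ hA hU7 V h h4 hι Φ isoF).Γof K₀)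
        ((componentAlbanesePinTotal hHD hI hU h₃ hA hU7 V h h4 hι Φ isoF).belowConjThree K₀), c ≠ 0) :
    (𝟙 ((sec42DataOf h isoF (pkgF L) ι₁ (pkgV V) Φ).A K₀) : _ ⟶ _) ≠ 0 := by
  obtain ⟨c, hc⟩ := hK
  obtain ⟨x, rfl⟩ := (bijective_albStarQ_componentAlbanesePinTotal_of_lemma24 hL V hU h₃ h4 h hHD hι hI hA hU7 Φ isoF K₀).2 c
  exact one_ne_zero_of_exists_betti_ne_zero' _ ⟨x, fun h0 => hc (by rw [h0, map_zero])⟩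

end Summit.HodgeConjecture.CorCM.D2Bridge.LevelQReps

end
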